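import Literature.AlgebraicGeometry.HodgeTheory.VHSDataHodgeLocusOverCurve
import HarnessLib

/-!
# Cattani–Deligne–Kaplan, Corollary 1.3 over a ONE-DIMENSIONAL base for the data `VHSData` of a polarized `ℤ`-variation: the set of points
# where SOME DETERMINATION of a multivalued flat integral class is of type `(p, p)` is the whole curve or a finite set

Topic `Literature/AlgebraicGeometry/HodgeTheory` (namespace `Literature.AlgebraicGeometry.Motives.VHSData`), the companion of
`HodgeTheory/VHSDataHodgeLocusOverCurve.lean` (Thm. 1.1 / Cor. 1.2 for `r = 1`: `hodgeLocusOfNormLe D p K` is `S` or finite) for ONE flat class,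
over `VHSDataHodgeLocusInteriorChart` (interior charts), `VHSDataHodgeLocusNearPuncture` (puncture charts) and
`Topology/LocallyFullOrIsolatedSubset` (everything or finite).  THEOREMS ONLY (no definition, no named fact, no instance; D-0026 net debt `0`).

PRINTED SOURCE, VERBATIM (E. Cattani, P. Deligne, A. Kaplan, *On the locus of Hodge classes*, J. Amer. Math. Soc. 8 (1995), p. 484).
«**Corollary 1.3.** Let `u` be a section of the local system `𝒱_ℤ` on a universal covering of `S`. The set of points in `S` where some
determination of `u` is of type `(0, 0)` is an algebraic subvariety of `S`.  *Proof.* Such a set is a union of images of connected components of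
`S^{(K)}`, for `K = Q(u, u)`.»

`VHSData` READING.  A section of `𝒱_ℤ` on the universal covering based at `s₀` is an integral vector `u₀ ∈ V_ℤ,s₀`; its DETERMINATIONS at `t` are
the parallel transports `γ · u₀ ∈ V_ℤ,t` along the homotopy classes `γ` of paths from `s₀` to `t` (`Motives.LocalSystem.transport`).  The set of
the corollary is `{t | ∃ γ : s₀ ⇝ t, γ · u₀ is of type (p, p) at t}`; all determinations have `Q(γ·u₀, γ·u₀) = Q(u₀, u₀)` (flatness of `Q`,
`form_transport_toRat`).  The charts of the Thm. 1.1 files are supplemented by their FLATNESS: two points of one chart are joined by a path class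
`δ` (inside the simply connected chart) whose parallel transport reads as the identity in the flat trivialization, `e_{c′}(δ · y) = e_c(y)`.
* §1 `exists_finite_determinationLocus_interior_chart_iff` — over an interior chart, the set of the corollary is cut out by FINITELY many flat
  values `v`: `ρ(c) ∈ {…} ⟺ ∃ v ∈ Υ′, h(c)(1 ⊗ v) ∈ F₀^p` («a union of images of connected components of `S^{(K)}`», one variable);
  `forall_mem_determinationLocus_or_forall_eventually_not_mem_interior_chart` — on a preconnected open chart it is everything or without
  accumulation point; `mem_nhds_or_eventually_not_mem_determinationLocus_at` — transferred to `S`.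
* §2 `forall_mem_determinationLocus_or_forall_not_mem_near_puncture` — near a puncture with unipotent monodromy it contains or avoids a
  punctured neighbourhood (Thm. 1.5 (ii) in the chart: a determination Hodge at one point beyond the threshold is Hodge in the chart at all of
  them, and by flatness it IS a determination at each).
* §3 **`determinationLocus_eq_univ_or_finite`** — **COR. 1.3 (`r = 1`): on a preconnected `S` with a compact core, flat interior charts at every
  point and flat unipotent puncture charts, the set of points where some determination of `u₀` is of type `(p, p)` is ALL of `S` or FINITE.**

NOT HERE: several-dimensional bases; the identification of this set with a union of images of components of `S^{(K)}` as spaces.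

## References

* [CattaniDeligneKaplan1995] E. Cattani, P. Deligne, A. Kaplan, *On the locus of Hodge classes*, J. Amer. Math. Soc. 8 (1995) 483–506: Cor. 1.3
  (p. 484), Thm. 1.1, Thm. 1.5, «Proof of 1.5 ⟹ 1.1» (p. 485).
* [Schmid1973] W. Schmid, *Variation of Hodge structure: the singularities of the period mapping*, Invent. Math. 22 (1973): §2 (flat
  trivializations over simply connected bases; cite only).
* [FritzscheGrauert2002] K. Fritzsche, H. Grauert, *From Holomorphic Functions to Complex Manifolds*, GTM 213 (2002), Ch. I §8.
-/

noncomputable section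

open scoped TensorProduct ComplexOrder
open _root_.Topology _root_.Filter Set

namespace Literature.AlgebraicGeometry

open Module
open Motives Motives.MixedHodgeStructure Motives.HodgeStructure
open Motives.HodgeStructure (conj ofRat ofRat_apply conj_ofRat)
open HodgeTheory

universe u

namespace Motives.VHSData

variable {S : Type} [TopologicalSpace S] {k : ℤ} (D : VHSData S k)
variable {V : Type u} [AddCommGroup V] [Module ℚ V]

/-! ## §0 Determinations: flat values and norms -/

/-- All determinations of `u₀` have the self-intersection of `u₀`: `Q_t(γ·u₀, γ·u₀) = Q_{s₀}(u₀, u₀) ≤ ⌈Q_{s₀}(u₀, u₀)⌉` («for `K = Q(u, u)`»).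
[cite: CattaniDeligneKaplan1995, Cor. 1.3 (p. 484)] [cite: Schmid1973, §2] -/
theorem form_transport_le_ceil {s₀ t : S} (γ : Path.Homotopic.Quotient s₀ t) (u₀ : D.VZ.fiber s₀) :
    (D.form t).form (D.toRat t (D.VZ.transport γ u₀)) (D.toRat t (D.VZ.transport γ u₀)) ≤
      ((⌈(D.form s₀).form (D.toRat s₀ u₀) (D.toRat s₀ u₀)⌉ : ℤ) : ℚ) := by
  rw [D.form_transport_toRat]
  exact Int.le_ceil _

/-- **Flatness of the chart carries determinations to determinations with the same flat value**: if `e_{t′}(δ · y) = e_t(y)` for a path class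
`δ : t ⇝ t′`, then the determination `(γ·δ) · u₀` at `t′` has flat value `e_{t′}((γ·δ)·u₀) = e_t(γ·u₀)`. [cite: Schmid1973, §2] -/
theorem equiv_toRat_transport_trans {s₀ t t' : S} (et : D.V.fiber t ≃ₗ[ℚ] V) (et' : D.V.fiber t' ≃ₗ[ℚ] V)
    (δ : Path.Homotopic.Quotient t t') (hδ : ∀ y : D.V.fiber t, et' (D.V.transport δ y) = et y) (γ : Path.Homotopic.Quotient s₀ t)
    (u₀ : D.VZ.fiber s₀) : et' (D.toRat t' (D.VZ.transport (γ.trans δ) u₀)) = et (D.toRat t (D.VZ.transport γ u₀)) := by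
  rw [← D.transport_toRat, LocalSystem.transport_trans, LinearMap.comp_apply, hδ, D.transport_toRat]

/-! ## §1 Interior charts: the set of the corollary is cut out by finitely many flat values -/

variable [FiniteDimensional ℚ V]

/-- **Over a flat interior chart, the set «some determination of `u₀` is of type `(p, p)`» is cut out by FINITELY many flat classes.**  Chart
`(ρ, U, e, H₀, P₀, h, Λ, κ)` as in `VHSDataHodgeLocusInteriorChart` (flag step `F^p_{ρ(c)} ↦ h(c)⁻¹F₀^p`, `Q ↦ Q₀`, `V_ℤ` into the finitely
generated `Λ`, comparison `κ‖1 ⊗ e_c x‖₀ ≤ ‖1 ⊗ x‖_{ρ(c)}`), FLAT: any two points `ρ(c)`, `ρ(c′)` are joined by a path class `δ` with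
`e_{c′}(δ · y) = e_c(y)`.  Then there is a finite `Υ′` with, for all `c ∈ U`:
**`(∃ γ : s₀ ⇝ ρ(c), γ·u₀ of type (p, p) at ρ(c)) ⟺ ∃ v ∈ Υ′, h(c)(1 ⊗ v) ∈ F₀^p`** («a union of images of connected components of `S^{(K)}`,
for `K = Q(u, u)`»). [cite: CattaniDeligneKaplan1995, Cor. 1.3 and §1 (p. 484)] [cite: Schmid1973, §2] -/
theorem exists_finite_determinationLocus_interior_chart_iff {p : ℤ} (hpk : p + p = k) {s₀ : S} (u₀ : D.VZ.fiber s₀) (ρ : ℂ → S) (U : Set ℂ)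
    (e : ∀ c : ℂ, D.V.fiber (ρ c) ≃ₗ[ℚ] V) (H₀ : HodgeStructure V k) (P₀ : H₀.Polarization) (h : ℂ → Module.End ℂ (ℂ ⊗[ℚ] V))
    (hF : ∀ c ∈ U, ((D.hodge (ρ c)).F p).map ((e c).toLinearMap.baseChange ℂ) = (H₀.F p).comap (h c))
    (Λ : Submodule ℤ V) (hΛ : Λ.FG) (hΛ₁ : ∀ c ∈ U, ∀ u : D.VZ.fiber (ρ c), e c (D.toRat (ρ c) u) ∈ Λ)
    {κ : ℝ} (hκ : 0 < κ) (hnorm : ∀ c ∈ U, ∀ x : D.V.fiber (ρ c), κ * P₀.hodgeNorm (ofRat (e c x)) ≤ (D.form (ρ c)).hodgeNorm (ofRat x))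
    (hflat : ∀ c ∈ U, ∀ c' ∈ U, ∃ δ : Path.Homotopic.Quotient (ρ c) (ρ c'), ∀ y : D.V.fiber (ρ c), e c' (D.V.transport δ y) = e c y) :
    ∃ Υ' : Set V, Υ'.Finite ∧ ∀ c ∈ U,
      (∃ γ : Path.Homotopic.Quotient s₀ (ρ c), D.IsHodgeAt (ρ c) p (D.VZ.transport γ u₀)) ↔ ∃ v ∈ Υ', h c (ofRat v) ∈ H₀.F p := by
  set K : ℤ := ⌈(D.form s₀).form (D.toRat s₀ u₀) (D.toRat s₀ u₀)⌉ with hK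
  -- the dictionary: Hodge at `ρ c` iff `h(c)(1 ⊗ flat value) ∈ F₀^p`
  have key : ∀ c ∈ U, ∀ u : D.VZ.fiber (ρ c), D.IsHodgeAt (ρ c) p u ↔ h c (ofRat (e c (D.toRat (ρ c) u))) ∈ H₀.F p :=
    fun c hc u => by rw [D.isHodgeAt_iff_ofRat_mem_of_map_F_eq (e c) (hF c hc) u, Submodule.mem_comap]
  set Υ' : Set V := {v : V | ∃ c ∈ U, ∃ γ : Path.Homotopic.Quotient s₀ (ρ c), e c (D.toRat (ρ c) (D.VZ.transport γ u₀)) = v ∧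
      D.IsHodgeAt (ρ c) p (D.VZ.transport γ u₀)} with hΥ'
  refine ⟨Υ', (D.finite_flatValues_isHodgeAt_interior_chart hpk ρ U e H₀ P₀ Λ hΛ hΛ₁ hκ hnorm K).subset ?_, fun c hc => ?_⟩
  · rintro v ⟨c, hc, γ, rfl, hH⟩
    exact ⟨c, hc, _, rfl, hH, D.form_transport_le_ceil γ u₀⟩
  constructor
  · rintro ⟨γ, hH⟩
    exact ⟨_, ⟨c, hc, γ, rfl, hH⟩, (key c hc _).1 hH⟩
  · rintro ⟨v, ⟨c₁, hc₁, γ, rfl, hH⟩, hmem⟩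
    obtain ⟨δ, hδ⟩ := hflat c₁ hc₁ c hc
    refine ⟨γ.trans δ, (key c hc _).2 ?_⟩
    rwa [D.equiv_toRat_transport_trans (e c₁) (e c) δ hδ γ u₀]

/-- **On a preconnected open flat interior chart: EITHER every `ρ(c)` carries a determination of `u₀` of type `(p, p)`, OR every `c₀ ∈ U` has a
punctured neighbourhood where no `ρ(c)` does** (identity principle on the finitely many loci `{h(c)v ∈ F₀^p}`).
[cite: CattaniDeligneKaplan1995, Cor. 1.3 and §1 (p. 484)] [cite: FritzscheGrauert2002, Ch. I §8 (after Prop. 8.1, n = 1)] -/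
theorem forall_mem_determinationLocus_or_forall_eventually_not_mem_interior_chart {p : ℤ} (hpk : p + p = k) {s₀ : S} (u₀ : D.VZ.fiber s₀)
    (ρ : ℂ → S) {U : Set ℂ} (hUo : IsOpen U) (hUc : IsPreconnected U)
    (e : ∀ c : ℂ, D.V.fiber (ρ c) ≃ₗ[ℚ] V) (H₀ : HodgeStructure V k) (P₀ : H₀.Polarization) (h : ℂ → Module.End ℂ (ℂ ⊗[ℚ] V))
    (hh : ∀ (φ : Module.Dual ℂ (ℂ ⊗[ℚ] V)) (w : ℂ ⊗[ℚ] V), AnalyticOnNhd ℂ (fun c => φ (h c w)) U)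
    (hF : ∀ c ∈ U, ((D.hodge (ρ c)).F p).map ((e c).toLinearMap.baseChange ℂ) = (H₀.F p).comap (h c))
    (Λ : Submodule ℤ V) (hΛ : Λ.FG) (hΛ₁ : ∀ c ∈ U, ∀ u : D.VZ.fiber (ρ c), e c (D.toRat (ρ c) u) ∈ Λ)
    {κ : ℝ} (hκ : 0 < κ) (hnorm : ∀ c ∈ U, ∀ x : D.V.fiber (ρ c), κ * P₀.hodgeNorm (ofRat (e c x)) ≤ (D.form (ρ c)).hodgeNorm (ofRat x))
    (hflat : ∀ c ∈ U, ∀ c' ∈ U, ∃ δ : Path.Homotopic.Quotient (ρ c) (ρ c'), ∀ y : D.V.fiber (ρ c), e c' (D.V.transport δ y) = e c y) :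
    (∀ c ∈ U, ∃ γ : Path.Homotopic.Quotient s₀ (ρ c), D.IsHodgeAt (ρ c) p (D.VZ.transport γ u₀)) ∨
      ∀ c₀ ∈ U, ∀ᶠ c in 𝓝[≠] c₀, ¬ ∃ γ : Path.Homotopic.Quotient s₀ (ρ c), D.IsHodgeAt (ρ c) p (D.VZ.transport γ u₀) := by
  obtain ⟨Υ', hΥ', hiff⟩ :=
    D.exists_finite_determinationLocus_interior_chart_iff hpk u₀ ρ U e H₀ P₀ h hF Λ hΛ hΛ₁ hκ hnorm hflat
  rcases exists_forall_mem_or_forall_eventually_forall_not_mem_of_analyticOnNhd hUc h hh (H₀.F p) (hΥ'.image ofRat) with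
    ⟨w, ⟨v, hv, rfl⟩, hall⟩ | hiso
  · exact Or.inl fun c hc => (hiff c hc).2 ⟨v, hv, hall c hc⟩
  · refine Or.inr fun c₀ hc₀ => ?_
    have hU : ∀ᶠ c in 𝓝[≠] c₀, c ∈ U := mem_nhdsWithin_of_mem_nhds (hUo.mem_nhds hc₀)
    filter_upwards [hiso c₀ hc₀, hU] with c hc hcU hmem
    obtain ⟨v, hv, hvF⟩ := (hiff c hcU).1 hmem
    exact hc (ofRat v) ⟨v, hv, rfl⟩ hvF

/-- Pull-back of a punctured-neighbourhood statement along a chart `ψ` at a point of its domain. [folklore] -/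
private theorem eventually_nhdsWithin_ne_of_chart'' (ψ : OpenPartialHomeomorph S ℂ) {x : S} (hx : x ∈ ψ.source)
    {P : ℂ → Prop} (hP : ∀ᶠ c in 𝓝[≠] (ψ x), P c) : ∀ᶠ y in 𝓝[≠] x, y ∈ ψ.source ∧ P (ψ y) := by
  have h1 : ∀ᶠ y in 𝓝[≠] x, y ∈ ψ.source := mem_nhdsWithin_of_mem_nhds (ψ.open_source.mem_nhds hx)
  have h2 : Tendsto ψ (𝓝[≠] x) (𝓝 (ψ x)) := (ψ.continuousAt hx).tendsto.mono_left nhdsWithin_le_nhds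
  have h3 : Tendsto ψ (𝓝[≠] x) (𝓝[≠] (ψ x)) := by
    refine tendsto_nhdsWithin_iff.2 ⟨h2, ?_⟩
    filter_upwards [h1, self_mem_nhdsWithin] with y hy hyx
    exact fun heq => hyx (ψ.injOn hy hx heq)
  filter_upwards [h1, h3.eventually hP] with y hy hPy
  exact ⟨hy, hPy⟩

/-- **At every point of a flat interior chart domain, the set «some determination of `u₀` is of type `(p, p)`» is a neighbourhood of the point
or is avoided by a punctured neighbourhood of it.**  Chart through `ψ : OpenPartialHomeomorph S ℂ` with preconnected target, data as in
`forall_mem_determinationLocus_or_forall_eventually_not_mem_interior_chart` for `ρ = ψ.symm`, `U = ψ.target`.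
[cite: CattaniDeligneKaplan1995, Cor. 1.3 and §1 (p. 484)] [cite: FritzscheGrauert2002, Ch. I §8 (after Prop. 8.1, n = 1)] -/
theorem mem_nhds_or_eventually_not_mem_determinationLocus_at {p : ℤ} (hpk : p + p = k) {s₀ : S} (u₀ : D.VZ.fiber s₀)
    (ψ : OpenPartialHomeomorph S ℂ) (hconn : IsPreconnected ψ.target)
    (e : ∀ c : ℂ, D.V.fiber (ψ.symm c) ≃ₗ[ℚ] V) (H₀ : HodgeStructure V k) (P₀ : H₀.Polarization) (h : ℂ → Module.End ℂ (ℂ ⊗[ℚ] V))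
    (hh : ∀ (φ : Module.Dual ℂ (ℂ ⊗[ℚ] V)) (w : ℂ ⊗[ℚ] V), AnalyticOnNhd ℂ (fun c => φ (h c w)) ψ.target)
    (hF : ∀ c ∈ ψ.target, ((D.hodge (ψ.symm c)).F p).map ((e c).toLinearMap.baseChange ℂ) = (H₀.F p).comap (h c))
    (Λ : Submodule ℤ V) (hΛ : Λ.FG) (hΛ₁ : ∀ c ∈ ψ.target, ∀ u : D.VZ.fiber (ψ.symm c), e c (D.toRat (ψ.symm c) u) ∈ Λ)
    {κ : ℝ} (hκ : 0 < κ)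
    (hnorm : ∀ c ∈ ψ.target, ∀ x : D.V.fiber (ψ.symm c), κ * P₀.hodgeNorm (ofRat (e c x)) ≤ (D.form (ψ.symm c)).hodgeNorm (ofRat x))
    (hflat : ∀ c ∈ ψ.target, ∀ c' ∈ ψ.target, ∃ δ : Path.Homotopic.Quotient (ψ.symm c) (ψ.symm c'),
      ∀ y : D.V.fiber (ψ.symm c), e c' (D.V.transport δ y) = e c y)
    {x : S} (hx : x ∈ ψ.source) :
    {t : S | ∃ γ : Path.Homotopic.Quotient s₀ t, D.IsHodgeAt t p (D.VZ.transport γ u₀)} ∈ 𝓝 x ∨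
      ∀ᶠ y in 𝓝[≠] x, y ∉ {t : S | ∃ γ : Path.Homotopic.Quotient s₀ t, D.IsHodgeAt t p (D.VZ.transport γ u₀)} := by
  rcases D.forall_mem_determinationLocus_or_forall_eventually_not_mem_interior_chart hpk u₀ ψ.symm ψ.open_target hconn e H₀ P₀ h hh hF
    Λ hΛ hΛ₁ hκ hnorm hflat with hall | hiso
  · refine Or.inl (Filter.mem_of_superset (ψ.open_source.mem_nhds hx) fun y hy => ?_)
    have h := hall (ψ y) (ψ.map_source hy)
    rwa [ψ.left_inv hy] at h
  · refine Or.inr ?_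
    filter_upwards [eventually_nhdsWithin_ne_of_chart'' ψ hx (hiso (ψ x) (ψ.map_source hx))] with y ⟨hy, hPy⟩
    rwa [ψ.left_inv hy] at hPy

/-! ## §2 Puncture charts: contains or avoids a punctured neighbourhood -/

/-- **Near a puncture with unipotent monodromy, the set «some determination of `u₀` is of type `(p, p)`» contains a punctured neighbourhood or
avoids one.**  Flat puncture chart `(σ, e, A₀)` of `VHSDataHodgeLocusNearPuncture` (flag step `F^p ↦ Φ^p(z)`, `Q ↦ Q`, `V_ℤ` into the `T`-stable
finitely generated `Λ`), FLAT: `σ(z)`, `σ(z′)` (`Im ≥ A₀`) are joined by a path class `δ` with `e_{z′}(δ · y) = e_z(y)`.  Then there is `A` such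
that EITHER every `σ(z)`, `Im z ≥ A`, carries a determination of `u₀` of type `(p, p)`, OR none does: a determination Hodge at `σ(z₁)` has flat
value `v` with `1 ⊗ v ∈ Φ^p(z′)` for all `Im z′ ≥ A` (Thm. 1.5 (ii) in the chart), and `v` is the flat value of the determination
`(γ₁·δ)·u₀` at `σ(z′)`. [cite: CattaniDeligneKaplan1995, Cor. 1.3 (p. 484), Thm. 1.5 (p. 485), Thm. 2.5 (p. 488)] [cite: Schmid1973, §2] -/
theorem forall_mem_determinationLocus_or_forall_not_mem_near_puncture (L : PolarizedLimitMixedHodgeStructure V k) {p : ℤ} (hpk : p + p = k)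
    {s₀ : S} (u₀ : D.VZ.fiber s₀) (Γ : ℂ → Module.End ℂ (ℂ ⊗[ℚ] V)) (hΓ0 : Γ 0 = 0)
    (hΓan : ∀ (φ : Module.Dual ℂ (ℂ ⊗[ℚ] V)) (w : ℂ ⊗[ℚ] V), AnalyticAt ℂ (fun s => φ (Γ s w)) 0)
    (hΓb : ∀ s : ℂ, Γ s ∈ ⨆ ab ∈ {ab : ℤ × ℤ | ab.1 ≤ -1}, L.toMixedHodgeStructure.endPiece ab.1 ab.2)
    (Λ : Submodule ℤ V) (hΛ : Λ.FG) (hΛT : ∀ u ∈ Λ, L.monodromy u ∈ Λ)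
    (σ : ℂ → S) (e : ∀ z : ℂ, D.V.fiber (σ z) ≃ₗ[ℚ] V) (A₀ : ℝ)
    (hF : ∀ z : ℂ, A₀ ≤ z.im → ((D.hodge (σ z)).F p).map ((e z).toLinearMap.baseChange ℂ) =
      ((L.F p).map (IsNilpotent.exp (Γ (Complex.exp (2 * Real.pi * Complex.I * z))))).map (IsNilpotent.exp (z • L.N.baseChange ℂ)))
    (hQ : ∀ z : ℂ, A₀ ≤ z.im → ∀ x y : D.V.fiber (σ z), (D.form (σ z)).form x y = L.Q (e z x) (e z y))
    (hΛ₁ : ∀ z : ℂ, A₀ ≤ z.im → ∀ u : D.VZ.fiber (σ z), e z (D.toRat (σ z) u) ∈ Λ)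
    (hflat : ∀ z z' : ℂ, A₀ ≤ z.im → A₀ ≤ z'.im → ∃ δ : Path.Homotopic.Quotient (σ z) (σ z'),
      ∀ y : D.V.fiber (σ z), e z' (D.V.transport δ y) = e z y) :
    ∃ A : ℝ, A₀ ≤ A ∧
      ((∀ z : ℂ, A ≤ z.im → ∃ γ : Path.Homotopic.Quotient s₀ (σ z), D.IsHodgeAt (σ z) p (D.VZ.transport γ u₀)) ∨
        (∀ z : ℂ, A ≤ z.im → ¬ ∃ γ : Path.Homotopic.Quotient s₀ (σ z), D.IsHodgeAt (σ z) p (D.VZ.transport γ u₀))) := by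
  set K : ℤ := ⌈(D.form s₀).form (D.toRat s₀ u₀) (D.toRat s₀ u₀)⌉ with hK
  obtain ⟨A₁, -, hA₀, hall, -⟩ := D.exists_threshold_isHodgeAt_chart L hpk Γ hΓ0 hΓan hΓb Λ hΛ hΛT σ e A₀ hF hQ hΛ₁ K
  refine ⟨A₁, hA₀, ?_⟩
  by_cases hex : ∃ z : ℂ, A₁ ≤ z.im ∧ ∃ γ : Path.Homotopic.Quotient s₀ (σ z), D.IsHodgeAt (σ z) p (D.VZ.transport γ u₀)
  · obtain ⟨z₁, hz₁, γ₁, hH₁⟩ := hex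
    refine Or.inl fun z' hz' => ?_
    obtain ⟨-, hev⟩ := hall z₁ hz₁ (D.VZ.transport γ₁ u₀) (D.form_transport_le_ceil γ₁ u₀) hH₁
    obtain ⟨δ, hδ⟩ := hflat z₁ z' (hA₀.trans hz₁) (hA₀.trans hz')
    refine ⟨γ₁.trans δ, (D.isHodgeAt_iff_ofRat_mem_of_map_F_eq (e z') (hF z' (hA₀.trans hz')) _).2 ?_⟩
    rw [D.equiv_toRat_transport_trans (e z₁) (e z') δ hδ γ₁ u₀]
    exact hev z' hz'
  · refine Or.inr fun z hz h => hex ⟨z, hz, h⟩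

/-! ## §3 Corollary 1.3 over a curve -/

/-- **Cattani–Deligne–Kaplan, COROLLARY 1.3 over a ONE-DIMENSIONAL base for `D : VHSData S k` (`k = p + p`).**  `S` preconnected; `u₀ ∈ V_ℤ,s₀` an
integral vector («a section of the local system `𝒱_ℤ` on a universal covering of `S`»).  FLAT INTERIOR CHARTS at every point `x` (an
`OpenPartialHomeomorph ψ` with `x` in its domain and preconnected target; `e c : V_{ψ⁻¹(c)} ≃ V` carrying `F^p` to `h(c)⁻¹F₀^p` with `h` weakly
holomorphic, `Q` to `Q₀`, `V_ℤ` into a finitely generated `Λ₀`, a comparison `κ‖1 ⊗ e_c x‖₀ ≤ ‖1 ⊗ x‖_{ψ⁻¹(c)}`, and path classes inside the chart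
with `e_{c′}(δ·y) = e_c(y)`), FLAT UNIPOTENT PUNCTURE CHARTS `i : ι` (`Lᵢ, Γᵢ, Λᵢ, σᵢ, eᵢ, A₀ᵢ` as in `VHSDataHodgeLocusNearPuncture`, with path
classes `e_{z′}(δ·y) = e_z(y)`), open images `σᵢ{Im z > A}` and a compact core for all heights.  Then **the set of points `t ∈ S` where SOME
determination `γ · u₀` (`γ : s₀ ⇝ t`) is of type `(p, p)` is ALL of `S` or a FINITE set** («is an algebraic subvariety of `S`», on a curve).
[cite: CattaniDeligneKaplan1995, Cor. 1.3 (p. 484), Thm. 1.1, Thm. 1.5 and «Proof of 1.5 ⟹ 1.1» (p. 485)] [cite: Schmid1973, §2 (cite only)]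
[cite: FritzscheGrauert2002, Ch. I §8] -/
theorem determinationLocus_eq_univ_or_finite [PreconnectedSpace S] {p : ℤ} (hpk : p + p = k) {s₀ : S} (u₀ : D.VZ.fiber s₀)
    -- flat interior charts at every point
    (hint : ∀ x : S, ∃ ψ : OpenPartialHomeomorph S ℂ, x ∈ ψ.source ∧ IsPreconnected ψ.target ∧
      ∃ (e : ∀ c : ℂ, D.V.fiber (ψ.symm c) ≃ₗ[ℚ] V) (H₀ : HodgeStructure V k) (P₀ : H₀.Polarization) (h : ℂ → Module.End ℂ (ℂ ⊗[ℚ] V))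
        (Λ₀ : Submodule ℤ V) (κ : ℝ),
        (∀ (φ : Module.Dual ℂ (ℂ ⊗[ℚ] V)) (w : ℂ ⊗[ℚ] V), AnalyticOnNhd ℂ (fun c => φ (h c w)) ψ.target) ∧
        (∀ c ∈ ψ.target, ((D.hodge (ψ.symm c)).F p).map ((e c).toLinearMap.baseChange ℂ) = (H₀.F p).comap (h c)) ∧
        Λ₀.FG ∧ (∀ c ∈ ψ.target, ∀ u : D.VZ.fiber (ψ.symm c), e c (D.toRat (ψ.symm c) u) ∈ Λ₀) ∧
        0 < κ ∧ (∀ c ∈ ψ.target, ∀ x : D.V.fiber (ψ.symm c), κ * P₀.hodgeNorm (ofRat (e c x)) ≤ (D.form (ψ.symm c)).hodgeNorm (ofRat x)) ∧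
        (∀ c ∈ ψ.target, ∀ c' ∈ ψ.target, ∃ δ : Path.Homotopic.Quotient (ψ.symm c) (ψ.symm c'),
          ∀ y : D.V.fiber (ψ.symm c), e c' (D.V.transport δ y) = e c y))
    -- flat puncture charts
    {ι : Type*} (L : ι → PolarizedLimitMixedHodgeStructure V k) (Γ : ι → ℂ → Module.End ℂ (ℂ ⊗[ℚ] V)) (hΓ0 : ∀ i, Γ i 0 = 0)
    (hΓan : ∀ (i : ι) (φ : Module.Dual ℂ (ℂ ⊗[ℚ] V)) (w : ℂ ⊗[ℚ] V), AnalyticAt ℂ (fun s => φ (Γ i s w)) 0)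
    (hΓb : ∀ (i : ι) (s : ℂ), Γ i s ∈ ⨆ ab ∈ {ab : ℤ × ℤ | ab.1 ≤ -1}, (L i).toMixedHodgeStructure.endPiece ab.1 ab.2)
    (Λ : ι → Submodule ℤ V) (hΛ : ∀ i, (Λ i).FG) (hΛT : ∀ i, ∀ u ∈ Λ i, (L i).monodromy u ∈ Λ i)
    (σ : ι → ℂ → S) (e : ∀ (i : ι) (z : ℂ), D.V.fiber (σ i z) ≃ₗ[ℚ] V) (A₀ : ι → ℝ)
    (hF : ∀ (i : ι) (z : ℂ), A₀ i ≤ z.im → ((D.hodge (σ i z)).F p).map ((e i z).toLinearMap.baseChange ℂ) =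
      (((L i).F p).map (IsNilpotent.exp (Γ i (Complex.exp (2 * Real.pi * Complex.I * z))))).map (IsNilpotent.exp (z • (L i).N.baseChange ℂ)))
    (hQ : ∀ (i : ι) (z : ℂ), A₀ i ≤ z.im → ∀ x y : D.V.fiber (σ i z), (D.form (σ i z)).form x y = (L i).Q (e i z x) (e i z y))
    (hΛ₁ : ∀ (i : ι) (z : ℂ), A₀ i ≤ z.im → ∀ u : D.VZ.fiber (σ i z), e i z (D.toRat (σ i z) u) ∈ Λ i)
    (hflat : ∀ (i : ι) (z z' : ℂ), A₀ i ≤ z.im → A₀ i ≤ z'.im → ∃ δ : Path.Homotopic.Quotient (σ i z) (σ i z'),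
      ∀ y : D.V.fiber (σ i z), e i z' (D.V.transport δ y) = e i z y)
    (hopen : ∀ (i : ι) (A : ℝ), A₀ i ≤ A → IsOpen (σ i '' {z : ℂ | A < z.im}))
    (hcore : ∀ A : ι → ℝ, (∀ i, A₀ i ≤ A i) → ∃ C : Set S, IsCompact C ∧ C ∪ ⋃ i, σ i '' {z : ℂ | A i < z.im} = univ) :
    {t : S | ∃ γ : Path.Homotopic.Quotient s₀ t, D.IsHodgeAt t p (D.VZ.transport γ u₀)} = univ ∨
      {t : S | ∃ γ : Path.Homotopic.Quotient s₀ t, D.IsHodgeAt t p (D.VZ.transport γ u₀)}.Finite := by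
  set Z : Set S := {t : S | ∃ γ : Path.Homotopic.Quotient s₀ t, D.IsHodgeAt t p (D.VZ.transport γ u₀)} with hZ
  -- the heights at the punctures
  have hend : ∀ i, ∃ A : ℝ, A₀ i ≤ A ∧ ((∀ z : ℂ, A ≤ z.im → σ i z ∈ Z) ∨ (∀ z : ℂ, A ≤ z.im → σ i z ∉ Z)) := fun i =>
    D.forall_mem_determinationLocus_or_forall_not_mem_near_puncture (L i) hpk u₀ (Γ i) (hΓ0 i) (hΓan i) (hΓb i) (Λ i) (hΛ i) (hΛT i)
      (σ i) (e i) (A₀ i) (hF i) (hQ i) (hΛ₁ i) (hflat i)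
  choose A hA₀ hA using hend
  obtain ⟨C, hC, hcov⟩ := hcore A hA₀
  refine Literature.Topology.eq_univ_or_finite_of_forall (fun x => ?_) hC (E := fun i => σ i '' {z : ℂ | A i < z.im})
    (fun i => hopen i (A i) (hA₀ i)) (by rw [hcov]; exact subset_univ _) fun i => ?_
  · obtain ⟨ψ, hx, hconn, e', H₀, P₀, h, Λ₀, κ, hh, hF', hΛ₀, hΛ₁', hκ, hnorm, hflat'⟩ := hint x
    exact D.mem_nhds_or_eventually_not_mem_determinationLocus_at hpk u₀ ψ hconn e' H₀ P₀ h hh hF' Λ₀ hΛ₀ hΛ₁' hκ hnorm hflat' hx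
  · rcases hA i with hall | hnone
    · refine Or.inl ?_
      rintro _ ⟨z, hz, rfl⟩
      exact hall z (le_of_lt hz)
    · refine Or.inr (Set.disjoint_left.2 ?_)
      rintro _ ⟨z, hz, rfl⟩
      exact hnone z (le_of_lt hz)

end Motives.VHSData

end Literature.AlgebraicGeometry

end
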